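import Literature.NumberTheory.Automorphic.HilbertRepMatrixCoefficients
import HarnessLib

/-!
# Cyclic vectors in a finite sum of inequivalent irreducibles, and multiplicity one
(Deitmar–Echterhoff, *Principles of Harmonic Analysis* (2014), §6.1: cyclic vectors (PDF p. 175) and
Exercise 6.11 (PDF p. 180); Cor. 6.1.9; §7.3, Theorem 7.3.2)

Topic `NumberTheory/Automorphic`; theorems only, no new definition, no named fact, no instance, over
the vocabulary of `HilbertRepSpectrum` / `DiscreteDecompositionCriterion` /
`HilbertRepIsotypicComponent` / `HilbertRepMatrixCoefficients` (`ClosedSubrep`, `generate`,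
`iSupClosure`, `isotypicMembers`, `isotypicComponent`, `coefficientAnnihilator`) for a unitary
representation `π` of a group `G` on a complex Hilbert space `H`.

* `ClosedSubrep.isOrtho_or_exists_le_areUnitarilyEquivalent` — **generalised Schur dichotomy**:
  an irreducible closed subrepresentation `V` and any closed subrepresentation `W` of a unitary
  `π` are either orthogonal, or `W` contains an irreducible closed subrepresentation unitarily
  equivalent to `V` (repackaging of `ClosedSubrep.exists_le_orthogonal_areUnitarilyEquivalent`
  applied to `Wᗮ`).
* `mem_of_mem_topologicalClosure_sup_of_mem_orthogonal` — Hilbert-space lemma: for `V` complete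
  and `V ⟂ W`, a vector of `closure (V ⊔ W)` orthogonal to `W` lies in `V`.
* `ClosedSubrep.le_generate_sum`, `ClosedSubrep.generate_sum_eq` — **the cyclic-vector criterion
  ("Goursat")**: for finitely many irreducible, pairwise inequivalent closed subrepresentations
  `V i` of a unitary `π` and `c i ∈ V i` all non-zero, the closed subrepresentation generated by
  `∑ c i` is the closed span of the `V i` — the vector `∑ c i` is cyclic for `⊕ V i` although that
  sum is reducible (Deitmar–Echterhoff, Exercise 6.11). Pairwise orthogonality is automatic
  (`ClosedSubrep.isOrtho_of_not_areUnitarilyEquivalent`, Cor. 6.1.9).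
* `ClosedSubrep.exists_inner_apply_ne_zero_of_mem_generate` — a non-zero vector of the closed
  subrepresentation generated by `u'` pairs with some translate of `u'`
  (`generate π {u'} ≤ coefficientAnnihilator π u` otherwise); hence
  `exists_inner_apply_sum_ne_zero`: every non-zero `u` in the closed span of the `V i` has
  `⟪π g (∑ c i), u⟫ ≠ 0` for some `g`; `IsUnitary.exists_mem_inner_apply_ne_zero_of_support`:
  pointwise transfer of a non-vanishing coefficient to a set `Λ` of double-coset representatives.
* **Multiplicity one.** `isotypicComponent_eq_of_subsingleton` and
  `isTopIrreducible_isotypicComponent_iff`: the `σ`-isotypic component of `π` is irreducible iff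
  the class of `σ` occurs in `π` with exactly one member (`(π.isotypicMembers σ).Subsingleton` and
  non-empty), in which case the component IS that member (Deitmar–Echterhoff, Thm. 7.3.2 (b): the
  isotype is a Hilbert sum of copies of `V_τ`, their number being the multiplicity);
  `not_subsingleton_isotypicMembers_of_isOrtho` — two orthogonal members refute it.

## Mathlib

`Submodule.starProjection`, `Submodule.topologicalClosure_minimal`, `iSup_split_single`,
`Submodule.isOrtho_iSup_right`; the tree's `ClosedSubrep.generate` / `iSupClosure` /
`isotypicComponent`. No Mathlib declaration is duplicated.

## Design notes

* DELIBERATE dot-notation extensions in `namespace ContRepresentation` /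
  `ContRepresentation.ClosedSubrep` / `ContRepresentation.IsUnitary`, as in `HilbertRepSpectrum`;
  the Hilbert-space lemma of §2 is stated in `namespace ContRepresentation` (not in `Submodule`)
  to stay out of Mathlib's namespace.
* Provenance. Generic layer of the adjudication package of the 2001 Hodge/CM manuscripts
  (`HodgeCM.RepDecomp`, files `Automorphic/GoursatPairing.lean` and `Automorphic/MultiplicityOne.lean`
  there, consumed by that package's "translates pair across finitely many twist classes" step)
  re-proved over the tree's vocabulary; nothing here is a claim of those manuscripts, and the
  multiplicity-one theorems of Rogawski that the package consumes as print facts are NOT stated here.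

## References

* A. Deitmar, S. Echterhoff, *Principles of Harmonic Analysis*, 2nd ed., Universitext, Springer
  (2014), §6.1 (cyclic vectors, PDF p. 175; Lemma 6.1.7; Cor. 6.1.9; Exercise 6.11, PDF p. 180),
  §7.3 (Theorem 7.3.2) [DeitmarEchterhoff2014].
* J. Dixmier, *C\*-algebras*, North-Holland (1977), §5.4, §13.1 [Dixmier1977].
-/

noncomputable section

open scoped InnerProductSpace

namespace ContRepresentation

section Hilbert

variable {G H H' : Type*} [Group G]
  [NormedAddCommGroup H] [InnerProductSpace ℂ H] [CompleteSpace H]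
  [NormedAddCommGroup H'] [InnerProductSpace ℂ H'] [CompleteSpace H']
  {π : ContRepresentation ℂ G H}

/-! ### 1. Generalised Schur dichotomy -/

/-- **Generalised Schur dichotomy**: an irreducible closed subrepresentation `V` and a closed
subrepresentation `W` of a unitary representation are either orthogonal, or `W` contains an
irreducible closed subrepresentation unitarily equivalent to `V` (Deitmar–Echterhoff (2014),
Cor. 6.1.9 and its proof). [cite: DeitmarEchterhoff2014, Cor. 6.1.9] -/
theorem ClosedSubrep.isOrtho_or_exists_le_areUnitarilyEquivalent (hπ : π.IsUnitary)
    (V W : ClosedSubrep π) (hV : V.toContRep.IsTopIrreducible) :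
    V.toSubmodule ⟂ W.toSubmodule ∨
      ∃ V' : ClosedSubrep π, V' ≤ W ∧ V'.toContRep.IsTopIrreducible ∧
        AreUnitarilyEquivalent V.toContRep V'.toContRep := by
  by_cases h : V ≤ W.orthogonal hπ
  · exact Or.inl (ClosedSubrep.isOrtho_of_le_orthogonal hπ h)
  · right
    obtain ⟨V', hle, he⟩ :=
      ClosedSubrep.exists_le_orthogonal_areUnitarilyEquivalent hπ (W.orthogonal hπ) V hV h
    rw [ClosedSubrep.orthogonal_orthogonal] at hle
    obtain ⟨e, he'⟩ := he
    exact ⟨V', hle, (isTopIrreducible_congr e).mp hV, ⟨e, he'⟩⟩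

/-! ### 2. A Hilbert-space lemma -/

omit [CompleteSpace H] in
/-- For `V` complete and `V ⟂ W`: a vector of the closure of `V ⊔ W` orthogonal to `W` lies in
`V` (apply `1 - P_V`, which maps `V ⊔ W` into `W`, hence the closure into `closure W ≤ Wᗮᗮ`).
[folklore] -/
theorem mem_of_mem_topologicalClosure_sup_of_mem_orthogonal {V W : Submodule ℂ H}
    [V.HasOrthogonalProjection] (hVW : V ⟂ W) {x : H} (hx : x ∈ (V ⊔ W).topologicalClosure)
    (hxW : x ∈ Wᗮ) : x ∈ V := by
  set P := V.starProjection with hP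
  have h1 : ∀ y ∈ V ⊔ W, y - P y ∈ W := by
    intro y hy
    obtain ⟨a, ha, b, hb, rfl⟩ := Submodule.mem_sup.mp hy
    have hPa : P a = a := Submodule.starProjection_eq_self_iff.mpr ha
    have hPb : P b = 0 := by
      rw [hP, Submodule.starProjection_apply_eq_zero_iff]
      exact Submodule.isOrtho_iff_le.mp hVW.symm hb
    rw [map_add, hPa, hPb, add_zero, add_sub_cancel_left]
    exact hb
  have h2 : x - P x ∈ W.topologicalClosure := by
    let f : H →L[ℂ] H := ContinuousLinearMap.id ℂ H - P
    have hle : V ⊔ W ≤ (W.topologicalClosure).comap (f : H →ₗ[ℂ] H) := fun y hy =>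
      W.le_topologicalClosure (h1 y hy)
    have hc : IsClosed (((W.topologicalClosure).comap (f : H →ₗ[ℂ] H) : Submodule ℂ H) : Set H) :=
      W.isClosed_topologicalClosure.preimage f.continuous
    exact (Submodule.topologicalClosure_minimal _ hle hc) hx
  have hWc : W.topologicalClosure ≤ Wᗮᗮ :=
    Submodule.topologicalClosure_minimal _ W.le_orthogonal_orthogonal
      (Submodule.isClosed_orthogonal _)
  have hWo : Wᗮ ≤ W.topologicalClosureᗮ := by
    intro y hy
    refine Submodule.orthogonal_le hWc ?_
    rwa [Submodule.triorthogonal_eq_orthogonal]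
  have hz : x - P x ∈ W.topologicalClosureᗮ :=
    Submodule.sub_mem _ (hWo hxW)
      (hWo (Submodule.isOrtho_iff_le.mp hVW (V.starProjection_apply_mem x)))
  have hz0 : x - P x = 0 := inner_self_eq_zero.mp (Submodule.inner_right_of_mem_orthogonal h2 hz)
  exact Submodule.starProjection_eq_self_iff.mp (sub_eq_zero.mp hz0).symm

/-! ### 3. The cyclic-vector criterion ("Goursat") -/

section Goursat

variable {ι : Type*} [Fintype ι] {V : ι → ClosedSubrep π} {c : ι → H}

omit [CompleteSpace H] in
/-- The inner product of the `j`-th component with the sum is its square norm (pairwise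
orthogonality). [folklore] -/
theorem inner_apply_sum_eq_inner_self
    (horth : Pairwise fun i j => (V i).toSubmodule ⟂ (V j).toSubmodule) (hc : ∀ i, c i ∈ V i)
    (j : ι) : ⟪c j, ∑ i, c i⟫_ℂ = ⟪c j, c j⟫_ℂ := by
  rw [inner_sum, Finset.sum_eq_single j]
  · intro i _ hij
    exact Submodule.inner_right_of_mem_orthogonal (K := (V j).toSubmodule) (hc j)
      (Submodule.isOrtho_iff_le.mp (horth hij) (hc i))
  · intro h
    exact absurd (Finset.mem_univ j) h

omit [Fintype ι] in
/-- Irreducible, pairwise inequivalent closed subrepresentations of a unitary representation are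
pairwise orthogonal (Deitmar–Echterhoff (2014), Cor. 6.1.9). [cite: DeitmarEchterhoff2014, Cor. 6.1.9] -/
theorem ClosedSubrep.pairwise_isOrtho_of_pairwise_not_areUnitarilyEquivalent (hπ : π.IsUnitary)
    (hV : ∀ i, (V i).toContRep.IsTopIrreducible)
    (hne : Pairwise fun i j => ¬ AreUnitarilyEquivalent (V i).toContRep (V j).toContRep) :
    Pairwise fun i j => (V i).toSubmodule ⟂ (V j).toSubmodule := fun _ _ hij =>
  ClosedSubrep.isOrtho_of_not_areUnitarilyEquivalent hπ (hV _) (hV _) (hne hij)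

omit [CompleteSpace H] in
/-- The sum `∑ c i` lies in the closed span of the `V i`. [folklore] -/
theorem ClosedSubrep.sum_mem_iSupClosure_range (hc : ∀ i, c i ∈ V i) :
    ∑ i, c i ∈ ClosedSubrep.iSupClosure (Set.range V) :=
  (ClosedSubrep.iSupClosure (Set.range V)).toSubmodule.sum_mem fun i _ =>
    ClosedSubrep.le_iSupClosure (Set.mem_range_self i) (hc i)

/-- **Cyclic-vector criterion ("Goursat")**: `V i` irreducible and pairwise inequivalent closed
subrepresentations of a unitary `π`, `c i ∈ V i` all non-zero; then every `V j` lies in the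
closed subrepresentation generated by `∑ c i`. Proof: `V j` is not orthogonal to it (the sum has
`j`-component `c j ≠ 0`), so by the dichotomy it contains an irreducible `V' ≃ V j`; `V'` is
orthogonal to the other `V i` (inequivalence) and lies in `closure (V j ⊔ ⨆_{i ≠ j} V i)`, hence
in `V j`, hence equals `V j` (Deitmar–Echterhoff (2014), §6.1 cyclic vectors and Exercise 6.11).
[cite: DeitmarEchterhoff2014, §6.1 (cyclic vectors; Exercise 6.11)] -/
theorem ClosedSubrep.le_generate_sum (hπ : π.IsUnitary) (hV : ∀ i, (V i).toContRep.IsTopIrreducible)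
    (hne : Pairwise fun i j => ¬ AreUnitarilyEquivalent (V i).toContRep (V j).toContRep)
    (hc : ∀ i, c i ∈ V i) (hc0 : ∀ i, c i ≠ 0) (j : ι) :
    V j ≤ ClosedSubrep.generate π {∑ i, c i} := by
  have horth := ClosedSubrep.pairwise_isOrtho_of_pairwise_not_areUnitarilyEquivalent hπ hV hne
  set N : ClosedSubrep π := ClosedSubrep.generate π {∑ i, c i} with hN
  have hu'N : ∑ i, c i ∈ N := ClosedSubrep.subset_generate _ (Set.mem_singleton _)
  rcases ClosedSubrep.isOrtho_or_exists_le_areUnitarilyEquivalent hπ (V j) N (hV j) with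
    h | ⟨V', hV'N, hV', heq⟩
  · exfalso
    have h0 : ⟪c j, ∑ i, c i⟫_ℂ = 0 :=
      Submodule.inner_right_of_mem_orthogonal (K := (V j).toSubmodule) (hc j)
        (Submodule.isOrtho_iff_le.mp h.symm hu'N)
    rw [inner_apply_sum_eq_inner_self horth hc j] at h0
    exact hc0 j (inner_self_eq_zero.mp h0)
  · -- `V'` is orthogonal to every other `V i` (inequivalence) …
    have hV'orth : ∀ i, i ≠ j → V'.toSubmodule ⟂ (V i).toSubmodule := by
      intro i hij
      refine ClosedSubrep.isOrtho_of_not_areUnitarilyEquivalent hπ hV' (hV i) fun h => ?_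
      exact hne (Ne.symm hij) (heq.trans h)
    -- … and lies in the closure of `⨆ V i = V j ⊔ ⨆_{i ≠ j} V i` …
    have hNle : N ≤ ClosedSubrep.iSupClosure (Set.range V) :=
      ClosedSubrep.generate_le
        (Set.singleton_subset_iff.mpr (ClosedSubrep.sum_mem_iSupClosure_range hc))
    have hcl : (ClosedSubrep.iSupClosure (Set.range V)).toSubmodule =
        ((V j).toSubmodule ⊔ ⨆ (i) (_ : i ≠ j), (V i).toSubmodule).topologicalClosure := by
      change (⨆ W ∈ Set.range V, (W : ClosedSubrep π).toSubmodule).topologicalClosure = _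
      rw [iSup_range, iSup_split_single (fun i => (V i).toSubmodule) j]
    have hjW : (V j).toSubmodule ⟂ ⨆ (i) (_ : i ≠ j), (V i).toSubmodule := by
      rw [Submodule.isOrtho_iSup_right]
      intro i
      rw [Submodule.isOrtho_iSup_right]
      intro hij
      exact horth (Ne.symm hij)
    have hV'W : V'.toSubmodule ⟂ ⨆ (i) (_ : i ≠ j), (V i).toSubmodule := by
      rw [Submodule.isOrtho_iSup_right]
      intro i
      rw [Submodule.isOrtho_iSup_right]
      intro hij
      exact hV'orth i hij
    -- … hence `V' ≤ V j`, so `V' = V j` by irreducibility.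
    haveI : CompleteSpace (V j).toSubmodule := (V j).isClosed.completeSpace_coe
    have hV'le : V' ≤ V j := by
      intro x hx
      have hx' : x ∈ ((V j).toSubmodule ⊔ ⨆ (i) (_ : i ≠ j), (V i).toSubmodule).topologicalClosure := by
        have := hNle (hV'N hx)
        rw [← ClosedSubrep.mem_toSubmodule, hcl] at this
        exact this
      exact mem_of_mem_topologicalClosure_sup_of_mem_orthogonal hjW hx'
        (Submodule.isOrtho_iff_le.mp hV'W hx)
    rcases ((ClosedSubrep.isTopIrreducible_toContRep_iff (V j)).mp (hV j)).2 V' hV'le with h | h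
    · exact absurd h (ClosedSubrep.ne_bot_of_isTopIrreducible hV')
    · rw [← h]
      exact hV'N

/-- **The closed subrepresentation generated by `∑ c i` is the closed span of the `V i`**
(same hypotheses). [cite: DeitmarEchterhoff2014, §6.1 (cyclic vectors; Exercise 6.11)] -/
theorem ClosedSubrep.generate_sum_eq (hπ : π.IsUnitary)
    (hV : ∀ i, (V i).toContRep.IsTopIrreducible)
    (hne : Pairwise fun i j => ¬ AreUnitarilyEquivalent (V i).toContRep (V j).toContRep)
    (hc : ∀ i, c i ∈ V i) (hc0 : ∀ i, c i ≠ 0) :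
    ClosedSubrep.generate π {∑ i, c i} = ClosedSubrep.iSupClosure (Set.range V) := by
  refine le_antisymm ?_ ?_
  · exact ClosedSubrep.generate_le
      (Set.singleton_subset_iff.mpr (ClosedSubrep.sum_mem_iSupClosure_range hc))
  · refine ClosedSubrep.iSupClosure_le ?_
    rintro W ⟨j, rfl⟩
    exact ClosedSubrep.le_generate_sum hπ hV hne hc hc0 j

end Goursat

/-! ### 4. Pairing -/

omit [CompleteSpace H] in
/-- A non-zero vector of the closed subrepresentation generated by `u'` pairs non-trivially with
some translate of `u'`: otherwise `generate π {u'} ≤ coefficientAnnihilator π u ∋ u`.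
[cite: DeitmarEchterhoff2014, §6.1 (cyclic vectors, before Lemma 6.1.7)] -/
theorem ClosedSubrep.exists_inner_apply_ne_zero_of_mem_generate {u u' : H}
    (hu : u ∈ ClosedSubrep.generate π {u'}) (hu0 : u ≠ 0) : ∃ g : G, ⟪π g u', u⟫_ℂ ≠ 0 := by
  by_contra h
  push Not at h
  have h1 : ClosedSubrep.generate π {u'} ≤ ClosedSubrep.coefficientAnnihilator π u :=
    ClosedSubrep.generate_le (Set.singleton_subset_iff.mpr h)
  exact hu0 (ClosedSubrep.eq_zero_of_mem_coefficientAnnihilator_self (h1 hu))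

/-- **Pairing across a finite sum of inequivalent irreducibles**: with `V`, `c` as in
`ClosedSubrep.le_generate_sum`, every non-zero `u` in the closed span of the `V i` has
`⟪π g (∑ c i), u⟫ ≠ 0` for some `g`. [cite: DeitmarEchterhoff2014, §6.1 (cyclic vectors; Exercise 6.11)] -/
theorem exists_inner_apply_sum_ne_zero {ι : Type*} [Fintype ι] {V : ι → ClosedSubrep π}
    {c : ι → H} (hπ : π.IsUnitary) (hV : ∀ i, (V i).toContRep.IsTopIrreducible)
    (hne : Pairwise fun i j => ¬ AreUnitarilyEquivalent (V i).toContRep (V j).toContRep)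
    (hc : ∀ i, c i ∈ V i) (hc0 : ∀ i, c i ≠ 0) {u : H}
    (hu : u ∈ ClosedSubrep.iSupClosure (Set.range V)) (hu0 : u ≠ 0) :
    ∃ g : G, ⟪π g (∑ i, c i), u⟫_ℂ ≠ 0 :=
  ClosedSubrep.exists_inner_apply_ne_zero_of_mem_generate
    (by rwa [ClosedSubrep.generate_sum_eq hπ hV hne hc hc0]) hu0

/-! ### 5. Pointwise support transfer -/

/-- **Pointwise support transfer** (unitary `π`): if every `g` at which `⟪π g u', u⟫ ≠ 0` factors
as `k' γ k` with `γ ∈ Λ`, `k` fixing `u'` and `k'` fixing `u`, then a non-vanishing coefficient is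
non-zero at some `γ ∈ Λ` (`⟪π (k' γ k) u', u⟫ = ⟪π γ u', u⟫`). [folklore] -/
theorem IsUnitary.exists_mem_inner_apply_ne_zero_of_support (hπ : π.IsUnitary) {Λ : Set G}
    {u u' : H}
    (hsupp : ∀ g : G, ⟪π g u', u⟫_ℂ ≠ 0 →
      ∃ k' : G, ∃ γ ∈ Λ, ∃ k : G, π k u' = u' ∧ π k' u = u ∧ g = k' * γ * k)
    (h : ∃ g : G, ⟪π g u', u⟫_ℂ ≠ 0) : ∃ γ ∈ Λ, ⟪π γ u', u⟫_ℂ ≠ 0 := by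
  obtain ⟨g, hg⟩ := h
  obtain ⟨k', γ, hγ, k, hk, hk', rfl⟩ := hsupp g hg
  exact ⟨γ, hγ, by rwa [hπ.inner_apply_doubleCoset_eq hk hk'] at hg⟩

/-- **The combination**: `V`, `c` as in `ClosedSubrep.le_generate_sum`, `u ≠ 0` in the closed span
of the `V i`, and the pointwise support factorisation through `Λ` ⇒ some `γ ∈ Λ` pairs `∑ c i` with
`u`. [cite: DeitmarEchterhoff2014, §6.1 (cyclic vectors; Exercise 6.11)] -/
theorem IsUnitary.exists_mem_inner_apply_sum_ne_zero_of_support {ι : Type*} [Fintype ι]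
    {V : ι → ClosedSubrep π} {c : ι → H} (hπ : π.IsUnitary)
    (hV : ∀ i, (V i).toContRep.IsTopIrreducible)
    (hne : Pairwise fun i j => ¬ AreUnitarilyEquivalent (V i).toContRep (V j).toContRep)
    (hc : ∀ i, c i ∈ V i) (hc0 : ∀ i, c i ≠ 0) {u : H}
    (hu : u ∈ ClosedSubrep.iSupClosure (Set.range V)) (hu0 : u ≠ 0) {Λ : Set G}
    (hsupp : ∀ g : G, ⟪π g (∑ i, c i), u⟫_ℂ ≠ 0 →
      ∃ k' : G, ∃ γ ∈ Λ, ∃ k : G, π k (∑ i, c i) = ∑ i, c i ∧ π k' u = u ∧ g = k' * γ * k) :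
    ∃ γ ∈ Λ, ⟪π γ (∑ i, c i), u⟫_ℂ ≠ 0 :=
  hπ.exists_mem_inner_apply_ne_zero_of_support hsupp
    (exists_inner_apply_sum_ne_zero hπ hV hne hc hc0 hu hu0)

/-! ### 6. Multiplicity one: the isotypic component is irreducible iff it has exactly one member -/

section MultiplicityOne

variable {σ : ContRepresentation ℂ G H'}

omit [CompleteSpace H] [CompleteSpace H'] in
/-- If the class of `σ` has at most one member `W`, the `σ`-isotypic component is `W`
(Deitmar–Echterhoff (2014), Thm. 7.3.2 (b)). [cite: DeitmarEchterhoff2014, Thm. 7.3.2] -/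
theorem isotypicComponent_eq_of_subsingleton (h : (π.isotypicMembers σ).Subsingleton)
    {W : ClosedSubrep π} (hW : W ∈ π.isotypicMembers σ) : π.isotypicComponent σ = W := by
  refine le_antisymm ?_ (ClosedSubrep.le_iSupClosure hW)
  refine ClosedSubrep.iSupClosure_le fun W' hW' => ?_
  rw [h hW' hW]

omit [CompleteSpace H] [CompleteSpace H'] in
/-- If the class of `σ` does not occur, the `σ`-isotypic component is zero. [folklore] -/
theorem isotypicComponent_eq_bot_of_isotypicMembers_eq_empty (h : π.isotypicMembers σ = ∅) :
    π.isotypicComponent σ = ⊥ :=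
  le_antisymm (ClosedSubrep.iSupClosure_le fun W hW => by simp [h] at hW) bot_le

omit [CompleteSpace H] [CompleteSpace H'] in
/-- If the `σ`-isotypic component is irreducible, every member of the class IS the component
(a member `W ≤` the component is `⊥` or everything). [cite: DeitmarEchterhoff2014, Thm. 7.3.2] -/
theorem eq_isotypicComponent_of_isTopIrreducible
    (h : (π.isotypicComponent σ).toContRep.IsTopIrreducible) {W : ClosedSubrep π}
    (hW : W ∈ π.isotypicMembers σ) : W = π.isotypicComponent σ := by
  rcases ((ClosedSubrep.isTopIrreducible_toContRep_iff _).mp h).2 W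
      (ClosedSubrep.le_iSupClosure hW) with h0 | h1
  · exact absurd h0 (ClosedSubrep.ne_bot_of_isTopIrreducible hW.1)
  · exact h1

omit [CompleteSpace H] [CompleteSpace H'] in
/-- **Multiplicity one ↔ irreducible isotypic component**: the `σ`-isotypic component of `π` is
topologically irreducible iff the class of `σ` occurs in `π` with exactly one member
(Deitmar–Echterhoff (2014), Thm. 7.3.2 (b): the isotype is a Hilbert sum of copies of `V_τ`).
[cite: DeitmarEchterhoff2014, Thm. 7.3.2] -/
theorem isTopIrreducible_isotypicComponent_iff :
    (π.isotypicComponent σ).toContRep.IsTopIrreducible ↔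
      (π.isotypicMembers σ).Nonempty ∧ (π.isotypicMembers σ).Subsingleton := by
  constructor
  · intro h
    refine ⟨?_, fun W hW W' hW' => ?_⟩
    · rcases (π.isotypicMembers σ).eq_empty_or_nonempty with h0 | h0
      · exact absurd (isotypicComponent_eq_bot_of_isotypicMembers_eq_empty h0)
          (ClosedSubrep.ne_bot_of_isTopIrreducible h)
      · exact h0
    · rw [eq_isotypicComponent_of_isTopIrreducible h hW,
        eq_isotypicComponent_of_isTopIrreducible h hW']
  · rintro ⟨⟨W, hW⟩, hs⟩
    rw [isotypicComponent_eq_of_subsingleton hs hW]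
    exact hW.1

omit [CompleteSpace H] [CompleteSpace H'] in
/-- **Two orthogonal members refute multiplicity one** (e.g. the two copies in `σ ⊕ σ`).
[cite: DeitmarEchterhoff2014, Thm. 7.3.2] -/
theorem not_subsingleton_isotypicMembers_of_isOrtho {V W : ClosedSubrep π}
    (hV : V ∈ π.isotypicMembers σ) (hW : W ∈ π.isotypicMembers σ)
    (hVW : V.toSubmodule ⟂ W.toSubmodule) : ¬ (π.isotypicMembers σ).Subsingleton := by
  intro hs
  have hVW' : V = W := hs hV hW
  subst hVW'
  have h0 : V.toSubmodule = ⊥ := Submodule.isOrtho_self.mp hVW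
  exact ClosedSubrep.ne_bot_of_isTopIrreducible hV.1 (ClosedSubrep.ext fun v => by
    change v ∈ V.toSubmodule ↔ v ∈ (⊥ : ClosedSubrep π)
    rw [h0, Submodule.mem_bot, ClosedSubrep.mem_bot])

omit [CompleteSpace H'] in
/-- Under multiplicity one, any two non-zero vectors of the `σ`-isotypic component pair under some
translate (`HilbertRepMatrixCoefficients`); for unitary `π` also in the two-sided form.
[cite: DeitmarEchterhoff2014, §6.1 (cyclic vectors, before Lemma 6.1.7)] -/
theorem exists_inner_apply_apply_ne_zero_of_subsingleton_isotypicMembers (hπ : π.IsUnitary)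
    (hne : (π.isotypicMembers σ).Nonempty) (hs : (π.isotypicMembers σ).Subsingleton) {u u' : H}
    (hu : u ∈ π.isotypicComponent σ) (hu0 : u ≠ 0) (hu' : u' ∈ π.isotypicComponent σ)
    (hu'0 : u' ≠ 0) (g' : G) : ∃ g : G, ⟪π g u, π g' u'⟫_ℂ ≠ 0 :=
  (π.isotypicComponent σ).exists_inner_apply_apply_ne_zero hπ
    (isTopIrreducible_isotypicComponent_iff.mpr ⟨hne, hs⟩) hu hu0 hu' hu'0 g'

end MultiplicityOne

end Hilbert

end ContRepresentation

end
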